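import Summits.QuantumFields.YangMills.Theorems.IR.AfPincerUcXCovFemtoTempered
import Summits.QuantumFields.YangMills.Theorems.IR.AfPincerUcXCovFemtoSharp

/-!
# Crux `IR` (stmt-QuantumFields-19354), line `af-pincer`, X-side (lane (1)A): the TEMPERED femto package NAMED and BY NAME —
# `Femto.TemperedFemtoAFAt G r u ⇒ SharpLanes.CovWindowAt G r (1/u)`, the sup package implies the tempered one, I♯_SC and the route decl

Sixth file of `Theorems/IR/AfPincerUcXCovFemto*` (seat ym-19354-afpincer-s2, generation 3): the by-name layer of `…XCovFemtoTempered`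
(`covWindow_of_temperedFemtoAF`), parallel to `…XCovFemtoSharp` for the exterior-uniform package.

* §1 `Femto.TemperedFemtoAFAt G r u` — NAME for the tempered femto conditional AF package in unit `u`: a collar `κ > 0`, a range `ℓ > 2κ`, `C₁ ≥ 0`,
  measurable GOOD sets `Good β c b` of exteriors, E1-osc ON GOOD, CondCovAF ON GOOD, and hyperscaling RARITY of the bad sets
  (`∀ D > 0`, eventually `μ_{β,L}(lift ∉ Good β c b) ≤ D · u(β)⁸` on every femto cube and torus).
* §2 `Femto.temperedFemtoAFAt_of_femtoAFAt : FemtoAFAt G r u → TemperedFemtoAFAt G r u` (`Good = univ`, bad mass `0`): the tempered ask is WEAKER.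
* §3 `Femto.covWindowAt_of_temperedFemtoAFAt : TemperedFemtoAFAt G r u → SharpLanes.CovWindowAt G r (1/u)`; the tempered lane contract
  `LaneATemperedContractSC` ⇒ `SharpLanes.LaneAContractSC` ⇒ `SharpOnset.OnsetSharpUKPcSC` (registered `stub_onsetSharpSC` type) ⇒ with the residual,
  `Theses.BalabanLadder.IR`; and `LaneAFemtoContractSC → LaneATemperedContractSC`.
* §4 ENVELOPE-FREE pointwise forms for a COMPACTLY SUPPORTED NT witness (owner's R105-compact candidate): from `SharpLanes.CovWindowAt G r (1/u)` alone
  (hence from either femto package) and a compact-witness two-point floor at unit `a`: the unit pin `a < T₀ u` (`unit_lt_mul_of_covWindowAt_compactWitness`),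
  the I♯ clause at `(G, r, a)` from the format at scale `1/u` (`onsetSharp_clause_of_covWindowAt_compactWitness`), and `GapInUnits G r a` from the format at
  one budget plus its clustering contract (`gapInUnits_of_covWindowAt_compactWitness`) — no `CovEnvelopeAt` anywhere.

HONEST FRAMING.  Names and kernel compositions among OPEN statements; nothing of asymptotic freedom, mixing or a gap is proved; one open gap-crux
of a CONDITIONAL chain (Track A 0/28 UV); not Clay.  No `sorry`; axioms ⊆ {propext, Classical.choice, Quot.sound}.
-/

set_option autoImplicit false

noncomputable section

open Filter Topology Finset MeasureTheory
open scoped BigOperators SchwartzMap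
open Literature.MathematicalPhysics.QuantumFieldTheory hiding ZdEdge
open Literature.MathematicalPhysics.QuantumLattice
open Literature.Probability.LatticeModels (Site box mem_box)
open Summit.QuantumFields.YangMills.Cruxes.OSLegsFromFemtoAndGap.DlrCollarTransfer

namespace Summit.QuantumFields.YangMills.Cruxes.IR.AfPincerUc.Femto

open Summit.QuantumFields.YangMills.Cruxes.IR.AfPincerUc
open Summit.QuantumFields.YangMills.Cruxes.IR.AfPincerUc.SharpLanes

/-! ## §1 The tempered package, NAMED -/
section Names

variable (G : Type) [Group G] [TopologicalSpace G] [IsTopologicalGroup G] [CompactSpace G]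
  [MeasurableSpace G] [BorelSpace G] (r : LatticeRep G)

/-- **The TEMPERED femto conditional AF package in unit `u`** (the hypotheses of `covWindow_of_temperedFemtoAF`, packaged): a physical
collar `κ > 0`, a femto range `ℓ > 2κ`, `C₁ ≥ 0`, measurable GOOD sets of exteriors `Good β c b` (one per coupling and femto cube), E1-osc
between good exteriors at physical depth `≥ κ`, CondCovAF for good exteriors, and hyperscaling RARITY of the bad sets under Wilson's measure of
every torus holding the cube.  OPEN (the robust form of the X-desk's femto ask). -/
def TemperedFemtoAFAt (u : ℝ → ℝ) : Prop :=
  ∃ (κ ℓ C₁ : ℝ) (Good : ℝ → (Fin 4 → ℤ) → ℕ → Set (LGConfig 4 G)), 0 < κ ∧ 2 * κ < ℓ ∧ 0 ≤ C₁ ∧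
    (∀ β c b, MeasurableSet (Good β c b)) ∧
    (∃ β₁ : ℝ, ∀ β : ℝ, β₁ ≤ β → ∀ (c : Fin 4 → ℤ) (b : ℕ), (b : ℝ) * u β ≤ ℓ →
      ∀ η ∈ Good β c b, ∀ η' ∈ Good β c b, ∀ x : Fin 4 → ℤ, κ / u β ≤ (depth c b x : ℝ) →
        |kerE G r β c b η (dens G r x) - kerE G r β c b η' (dens G r x)| ≤ C₁ / (depth c b x : ℝ) ^ 4) ∧
    (∃ n₀ : ℕ, ∀ W' : ℝ, 0 < W' → ∃ s' β' : ℝ, 0 < s' ∧ ∀ β : ℝ, β' ≤ β →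
      ∀ (c : Fin 4 → ℤ) (b : ℕ), (b : ℝ) * u β ≤ ℓ → ∀ η ∈ Good β c b, ∀ x y : Fin 4 → ℤ,
        (n₀ : ℝ) ≤ ‖siteToE (y - x)‖ → κ / u β ≤ (depth c b x : ℝ) → κ / u β ≤ (depth c b y : ℝ) →
          ‖siteToE (y - x)‖ * u β ≤ s' →
            ‖siteToE (y - x)‖ ^ 8 * |kerCov G r β c b η (dens G r x) (dens G r y)| ≤ W') ∧
    (∀ D : ℝ, 0 < D → ∃ βD : ℝ, ∀ β : ℝ, βD ≤ β → ∀ (c : Fin 4 → ℤ) (b : ℕ), (b : ℝ) * u β ≤ ℓ →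
      ∀ L : ℕ, b + 3 ≤ 2 * L + 1 →
        (wilsonMeasure (d := 4) (L := 2 * L + 1) r.ρ β).real ((torusLift (2 * L + 1)) ⁻¹' Good β c b)ᶜ ≤ D * u β ^ 8)

end Names

/-! ## §2 The exterior-uniform package implies the tempered one -/
section Weaker

variable {G : Type} [Group G] [TopologicalSpace G] [IsTopologicalGroup G] [CompactSpace G]
  [MeasurableSpace G] [BorelSpace G]

/-- **`FemtoAFAt ⇒ TemperedFemtoAFAt` (PROVED): take `Good = univ`, bad mass `0`.**  So the tempered ask is weaker than the exterior-uniform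
one (and survives exteriors that force a smooth background, provided they are `o(u⁸)`-rare). [bookkeeping] -/
theorem temperedFemtoAFAt_of_femtoAFAt (r : LatticeRep G) {u : ℝ → ℝ} (hu : ∀ β, 0 < u β) (h : FemtoAFAt G r u) :
    TemperedFemtoAFAt G r u := by
  obtain ⟨κ, ℓ, C₁, hκ, hκℓ, hC₁, ⟨β₁, hE1⟩, ⟨n₀, hAF⟩⟩ := h
  refine ⟨κ, ℓ, C₁, fun _ _ _ => Set.univ, hκ, hκℓ, hC₁, fun _ _ _ => MeasurableSet.univ, ?_, ?_, ?_⟩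
  · exact ⟨β₁, fun β hβ c b hfem η _ η' _ x hx => hE1 β hβ c b hfem η η' x hx⟩
  · refine ⟨n₀, fun W' hW' => ?_⟩
    obtain ⟨s', β', hs', hβ⟩ := hAF W' hW'
    exact ⟨s', β', hs', fun β hb c b hfem η _ x y hn hx hy hsep => hβ β hb c b hfem η x y hn hx hy hsep⟩
  · intro D hD
    refine ⟨0, fun β _ c b _ L _ => ?_⟩
    have h0 : (wilsonMeasure (d := 4) (L := 2 * L + 1) r.ρ β).real
        ((torusLift (2 * L + 1)) ⁻¹' (Set.univ : Set (LGConfig 4 G)))ᶜ = 0 := by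
      simp
    rw [h0]
    exact mul_nonneg hD.le (pow_nonneg (hu β).le 8)

end Weaker

/-! ## §3 The WINDOW, the lane contract, I♯_SC and the route decl BY NAME from the tempered package -/
section ByName

variable {G : Type} [Group G] [TopologicalSpace G] [IsTopologicalGroup G] [CompactSpace G]
  [MeasurableSpace G] [BorelSpace G]

/-- **`SharpLanes.CovWindowAt G r (1/u)` from the TEMPERED femto package (PROVED reduction, `covWindow_of_temperedFemtoAF`).**
[kernel reduction; hypotheses OPEN] -/
theorem covWindowAt_of_temperedFemtoAFAt (r : LatticeRep G) {u : ℝ → ℝ} (hu : ∀ β, 0 < u β) (h : TemperedFemtoAFAt G r u) :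
    CovWindowAt G r (fun β => 1 / u β) := by
  obtain ⟨κ, ℓ, C₁, Good, hκ, hκℓ, hC₁, hGm, hE1, hAF, hrare⟩ := h
  exact covWindow_of_temperedFemtoAF r u hu hκ hκℓ hC₁ Good hGm hE1 hAF hrare

end ByName

/-- **Lane (1)A contract, TEMPERED femto form (SC family).**  Per simply connected `(G, r)`: admissible `(n, ε)`, a positive unit map `u`, the
I-side format at scale `1/u`, the ENVELOPE and the TEMPERED femto conditional AF package in unit `u`. -/
def LaneATemperedContractSC : Prop :=
  ∀ (G : Type) [Group G] [TopologicalSpace G] [IsTopologicalGroup G] [CompactSpace G],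
    IsCompactSimpleLieGroup G → SimplyConnectedSpace G →
    letI : MeasurableSpace G := borel G; haveI : BorelSpace G := ⟨rfl⟩;
    ∀ r : LatticeRep G, ∃ (n : ℕ) (ε : ℝ), 1 ≤ n ∧ 0 ≤ ε ∧ ε * OnsetFormats.shellCount n ≤ 3 / 4 ∧
      ∃ u : ℝ → ℝ, (∀ β, 0 < u β) ∧ TypFormatAtScaleAt r.ρ n ε (fun β => 1 / u β) ∧ CovEnvelopeAt G r ∧
        TemperedFemtoAFAt G r u

/-- The femto contract implies the tempered contract (PROVED, `temperedFemtoAFAt_of_femtoAFAt`). -/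
theorem laneATemperedContractSC_of_femto (h : LaneAFemtoContractSC) : LaneATemperedContractSC := by
  intro G _ _ _ _ hG hsc
  letI : MeasurableSpace G := borel G
  haveI : BorelSpace G := ⟨rfl⟩
  intro r
  obtain ⟨n, ε, hn, hε, hM, u, hu, hF, henv, hfem⟩ := h G hG hsc r
  exact ⟨n, ε, hn, hε, hM, u, hu, hF, henv, temperedFemtoAFAt_of_femtoAFAt r hu hfem⟩

/-- **Tempered contract ⇒ the LEAD's lane (1)A contract (PROVED).** -/
theorem laneAContractSC_of_tempered (h : LaneATemperedContractSC) : LaneAContractSC := by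
  intro G _ _ _ _ hG hsc
  letI : MeasurableSpace G := borel G
  haveI : BorelSpace G := ⟨rfl⟩
  intro r
  obtain ⟨n, ε, hn, hε, hM, u, hu, hF, henv, hfem⟩ := h G hG hsc r
  exact ⟨n, ε, hn, hε, hM, fun β => 1 / u β, hF, henv, covWindowAt_of_temperedFemtoAFAt r hu hfem⟩

/-- **Tempered contract ⇒ I♯_SC = the registered `stub_onsetSharpSC` type, BY NAME (PROVED composition).** [hypotheses OPEN] -/
theorem onsetSharpUKPcSC_of_laneATemperedContractSC (h : LaneATemperedContractSC) : SharpOnset.OnsetSharpUKPcSC :=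
  onsetSharpUKPcSC_of_laneAContractSC (laneAContractSC_of_tempered h)

/-- **Tempered contract ∧ residual ⇒ `Theses.BalabanLadder.IR` BY NAME (PROVED composition; E discharged by p524017, no X-stub).** -/
theorem ir_of_laneATemperedContractSC (h : LaneATemperedContractSC) (hN : SharpOnset.IRNSC) :
    Summit.QuantumFields.YangMills.Theses.BalabanLadder.IR :=
  ir_of_laneAContractSC (laneAContractSC_of_tempered h) hN

/-! ## §4 Envelope-free pointwise forms for a compactly supported NT witness (R105-compact) -/
section Compact

variable {G : Type} [Group G] [TopologicalSpace G] [IsTopologicalGroup G] [CompactSpace G]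
  [MeasurableSpace G] [BorelSpace G]

/-- **The unit pin WITHOUT envelope (PROVED):** the WINDOW at scale `1/u` and a two-point floor at unit `a` carried by a COMPACTLY SUPPORTED
positive-time test function give `T₀, β₁` with `a(β) < T₀ · u(β)` for `β ≥ β₁` (generation 2's `afBelowScale_clause_of_covarianceAF_of_compact` +
`scale_pinned_of_witness`). [kernel composition; the window is OPEN] -/
theorem unit_lt_mul_of_covWindowAt_compactWitness (r : LatticeRep G) (a u : ℝ → ℝ) (ha : ∀ β, 0 < a β) (hu : ∀ β, 0 < u β)
    (hwin : CovWindowAt G r (fun β => 1 / u β))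
    (hlbc : ∃ (v : 𝓢(EuclideanSpace ℝ (Fin 4), ℝ)) (ε₅ β₅ Λ₅ : ℝ),
      tsupport v ⊆ {y : EuclideanSpace ℝ (Fin 4) | 0 < y 0} ∧ HasCompactSupport v ∧ 0 < ε₅ ∧
        ∀ β : ℝ, β₅ ≤ β → ∀ L : ℕ, Λ₅ ≤ a β * L → ε₅ ≤ Q2 G r β L (a β) (thetaTest 4 v) v) :
    ∃ T₀ β₁ : ℝ, ∀ β : ℝ, β₁ ≤ β → a β < T₀ * u β := by
  obtain ⟨v, ε₅, β₅, Λ₅, hv, hvc, hε₅, hlow⟩ := hlbc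
  obtain ⟨T, β₁, hT⟩ := afBelowScale_clause_of_covarianceAF_of_compact r (fun β => 1 / u β) hwin v hv hvc (half_pos hε₅)
  have hpin := scale_pinned_of_witness r a (fun β => 1 / u β) ha hlow hT hε₅
  refine ⟨T, max β₁ β₅, fun β hβ => ?_⟩
  have h1 := hpin β hβ
  have hu' := hu β
  have e : a β * (1 / u β) = a β / u β := by ring
  rw [e, div_lt_iff₀ hu'] at h1
  exact h1

/-- **The I♯ clause at `(G, r, a)` WITHOUT envelope (PROVED):** WINDOW at `1/u` + compact-witness floor at `a` + the format at scale `1/u`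
⇒ for every budget `δ`, eventually a mesh `b` with `a β · b < T` carrying `TypShellCondUKPc` (pin + `SharpLanes.typFormatAtScaleAt_mono` +
`SharpLanes.onsetSharpAt_iff_typFormatAtScaleAt_inv`). [kernel composition; hypotheses OPEN] -/
theorem onsetSharp_clause_of_covWindowAt_compactWitness (r : LatticeRep G) (a u : ℝ → ℝ) (ha : ∀ β, 0 < a β)
    (hu : ∀ β, 0 < u β) (hwin : CovWindowAt G r (fun β => 1 / u β))
    (hlbc : ∃ (v : 𝓢(EuclideanSpace ℝ (Fin 4), ℝ)) (ε₅ β₅ Λ₅ : ℝ),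
      tsupport v ⊆ {y : EuclideanSpace ℝ (Fin 4) | 0 < y 0} ∧ HasCompactSupport v ∧ 0 < ε₅ ∧
        ∀ β : ℝ, β₅ ≤ β → ∀ L : ℕ, Λ₅ ≤ a β * L → ε₅ ≤ Q2 G r β L (a β) (thetaTest 4 v) v)
    {n : ℕ} {ε : ℝ} (hF : TypFormatAtScaleAt r.ρ n ε (fun β => 1 / u β)) :
    ∀ δ : ℝ, 0 < δ → ∃ T β₂ : ℝ, ∀ β : ℝ, β₂ ≤ β →
      ∃ b : ℕ, 1 ≤ b ∧ a β * (b : ℝ) < T ∧ TypShellCondUKPc r.ρ β b n ε δ := by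
  obtain ⟨T₀, β₁, hT⟩ := unit_lt_mul_of_covWindowAt_compactWitness r a u ha hu hwin hlbc
  have hT0 : 0 < max T₀ 1 := lt_max_of_lt_right one_pos
  have hF' : TypFormatAtScaleAt r.ρ n ε (fun β => 1 / a β) := by
    refine typFormatAtScaleAt_mono hF hT0 ⟨β₁, fun β hβ => ?_⟩
    have h1 := hT β hβ
    have ha' := ha β
    have hu' := hu β
    -- `1/u ≤ max T₀ 1 · (1/a)` from `a < T₀ u`
    rw [mul_one_div, div_le_div_iff₀ hu' ha', one_mul]
    calc a β ≤ T₀ * u β := h1.le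
      _ ≤ max T₀ 1 * u β := mul_le_mul_of_nonneg_right (le_max_left _ _) hu'.le
  exact (onsetSharpAt_iff_typFormatAtScaleAt_inv r.ρ a ha n ε).mpr hF'

/-- **`GapInUnits G r a` WITHOUT envelope (PROVED):** WINDOW at `1/u` + compact-witness floor at `a` + the format at one budget `δ₀` at scale `1/u`
+ its clustering contract at rate `κ > 0` ⇒ the crux's conclusion at `(G, r, a)` (generation 2's
`gapInUnits_of_window_format_clustering_of_compactWitness` at `ℓ = 1/u`). [kernel composition; hypotheses OPEN] -/
theorem gapInUnits_of_covWindowAt_compactWitness (r : LatticeRep G) (a u : ℝ → ℝ) (ha : ∀ β, 0 < a β)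
    (hwin : CovWindowAt G r (fun β => 1 / u β)) {n : ℕ} {ε δ₀ κ : ℝ} {s₀ : ℕ} (hκ : 0 < κ)
    (hcl : FmtClustering r (fun β b => TypShellCondUKPc r.ρ β b n ε δ₀) κ s₀)
    (hF : ∃ B β₂ : ℝ, 0 < B ∧ ∀ β : ℝ, β₂ ≤ β → ∃ b : ℕ, 1 ≤ b ∧ (b : ℝ) ≤ B * (1 / u β) ∧ TypShellCondUKPc r.ρ β b n ε δ₀)
    (hlbc : ∃ (v : 𝓢(EuclideanSpace ℝ (Fin 4), ℝ)) (ε₅ β₅ Λ₅ : ℝ),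
      tsupport v ⊆ {y : EuclideanSpace ℝ (Fin 4) | 0 < y 0} ∧ HasCompactSupport v ∧ 0 < ε₅ ∧
        ∀ β : ℝ, β₅ ≤ β → ∀ L : ℕ, Λ₅ ≤ a β * L → ε₅ ≤ Q2 G r β L (a β) (thetaTest 4 v) v) :
    GapInUnits G r a :=
  gapInUnits_of_window_format_clustering_of_compactWitness r a (fun β => 1 / u β) ha hκ hcl hF hwin hlbc

end Compact

end Summit.QuantumFields.YangMills.Cruxes.IR.AfPincerUc.Femto

end
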